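import Literature.Probability.LatticeModels.ObservableContinuumBounds
import HarnessLib

/-!
# Subsequential local uniform limits of `F_δ/√δ`, for an abstract family of bond functions

Topic `Literature/Probability/LatticeModels`; the observable-independent form of
`IsDiscretisation.exists_subseq_limit` (`ObservableContinuumBounds.lean`; Smirnov 2010, end of §5;
Chelkak–Hongler–Izyurov 2015, §3.5: "by passing to a subsequence and applying the diagonal process,
we can assume that `ϑ(δ)^{-1} F_δ` tends to a limit `f̃` … uniformly on compact subsets"): given,
on every compact of the open set `D`, a `√δ` sup bound and a `√δ`-equicontinuity bound for the
horizontal edge values (the outputs of `LatticeToContinuumSup.lean` / `LatticeToContinuumLip.lean`),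
every sequence of meshes `δ_n → 0⁺` has a subsequence along which
`z ↦ δ^{-1/2} F_δ(cSrc (nearestSite δ z, 0))` converges uniformly on every compact of `D` to a
function continuous on `D` (`ScalingLimitCompactness.lean`). Everything is proved; no named fact.

## References

* S. Smirnov, Ann. of Math. 172 (2010), §5 [Smirnov2010].
* D. Chelkak, C. Hongler, K. Izyurov, Ann. of Math. 181 (2015), §3.5 (proof of Thm 2.16)
  [ChelkakHonglerIzyurovAnnals2015].
-/

noncomputable section

namespace Literature.Probability.LatticeModels

open Filter _root_.Topology Metric Set Finset

/-- The renormalised family read at the horizontal edge of the nearest site. [cite: Smirnov2010, §5] -/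
def scaledEdgeFamily (F : ℝ → MedialVertex → ℂ) (s : ℕ → ℝ) (n : ℕ) (z : ℂ) : ℂ :=
  ((Real.sqrt (s n))⁻¹ : ℂ) * F (s n) (cSrc (nearestSite (s n) z, 0))

/-- **Precompactness of `F_δ/√δ` from the two continuum-scale bounds.** [cite: Smirnov2010, §5; ChelkakHonglerIzyurovAnnals2015, §3.5] -/
theorem exists_subseq_limit_of_bounds {F : ℝ → MedialVertex → ℂ} {D : Set ℂ} (hD : IsOpen D)
    (hsup : ∀ K ⊆ D, IsCompact K → ∃ M : ℝ, 0 ≤ M ∧ ∀ᶠ δ in 𝓝[>] (0 : ℝ), ∀ x : Site 2, meshPoint δ x ∈ K →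
      ‖F δ (cSrc (x, 0))‖ ≤ M * Real.sqrt δ)
    (heq : ∀ K ⊆ D, IsCompact K → ∃ L : ℝ, 0 ≤ L ∧ ∀ᶠ δ in 𝓝[>] (0 : ℝ), ∀ x x' : Site 2,
      meshPoint δ x ∈ K → meshPoint δ x' ∈ K →
        ‖F δ (cSrc (x', 0)) - F δ (cSrc (x, 0))‖ ≤ L * Real.sqrt δ * (dist (meshPoint δ x') (meshPoint δ x) + δ))
    {s : ℕ → ℝ} (hs : Tendsto s atTop (𝓝[>] (0 : ℝ))) :
    ∃ φ : ℕ → ℕ, StrictMono φ ∧ ∃ g : ℂ → ℂ, ContinuousOn g D ∧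
      ∀ K ⊆ D, IsCompact K → TendstoUniformlyOn (fun k z => scaledEdgeFamily F s (φ k) z) g atTop K := by
  set u : ℕ → ℂ → ℂ := fun n z => scaledEdgeFamily F s n z with hu
  have hs0 : Tendsto s atTop (𝓝 (0 : ℝ)) := hs.mono_right nhdsWithin_le_nhds
  refine exists_subseq_tendstoUniformlyOn_of_asympEquicontinuous hD u s hs0 ?_ ?_
  · -- boundedness on compacts
    intro K hKD hK
    obtain ⟨r, hr, hrD⟩ := hK.exists_cthickening_subset_open hD hKD
    have hK₁ : IsCompact (cthickening r K) := hK.cthickening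
    obtain ⟨M, hM0, hM⟩ := hsup _ hrD hK₁
    refine ⟨M, ?_⟩
    have hr' : ∀ᶠ δ in 𝓝[>] (0 : ℝ), δ ≤ r := nhdsWithin_le_nhds (Iic_mem_nhds hr)
    have hall := hs.eventually (hM.and (hr'.and (self_mem_nhdsWithin : ∀ᶠ δ in 𝓝[>] (0:ℝ), 0 < δ)))
    refine hall.mono fun n hn z hz => ?_
    obtain ⟨hMn, hrn, hn0⟩ := hn
    have hx : meshPoint (s n) (nearestSite (s n) z) ∈ cthickening r K :=
      Metric.mem_cthickening_of_dist_le _ z _ _ hz ((dist_meshPoint_nearestSite_le hn0 z).trans hrn)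
    have key := hMn (nearestSite (s n) z) hx
    simp only [hu, scaledEdgeFamily, norm_mul, norm_inv, Complex.norm_real, Real.norm_eq_abs,
      abs_of_nonneg (Real.sqrt_nonneg _)]
    have hsq : 0 < Real.sqrt (s n) := Real.sqrt_pos.2 hn0
    rw [inv_mul_le_iff₀ hsq]
    linarith
  · -- asymptotic equicontinuity on compacts
    intro K hKD hK
    obtain ⟨r, hr, hrD⟩ := hK.exists_cthickening_subset_open hD hKD
    have hK₁ : IsCompact (cthickening r K) := hK.cthickening
    obtain ⟨L, hL0, hL⟩ := heq _ hrD hK₁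
    refine ⟨3 * L, by positivity, ?_⟩
    have hr' : ∀ᶠ δ in 𝓝[>] (0 : ℝ), δ ≤ r := nhdsWithin_le_nhds (Iic_mem_nhds hr)
    have hall := hs.eventually (hL.and (hr'.and (self_mem_nhdsWithin : ∀ᶠ δ in 𝓝[>] (0:ℝ), 0 < δ)))
    refine hall.mono fun n hn z hz z' hz' => ?_
    obtain ⟨hLn, hrn, hn0⟩ := hn
    set x := nearestSite (s n) z
    set x' := nearestSite (s n) z'
    have hx : meshPoint (s n) x ∈ cthickening r K :=
      Metric.mem_cthickening_of_dist_le _ z _ _ hz ((dist_meshPoint_nearestSite_le hn0 z).trans hrn)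
    have hx' : meshPoint (s n) x' ∈ cthickening r K :=
      Metric.mem_cthickening_of_dist_le _ z' _ _ hz' ((dist_meshPoint_nearestSite_le hn0 z').trans hrn)
    have key := hLn x' x hx' hx
    have hd : dist (meshPoint (s n) x) (meshPoint (s n) x') ≤ ‖z - z'‖ + 2 * s n := by
      calc dist (meshPoint (s n) x) (meshPoint (s n) x')
          ≤ dist (meshPoint (s n) x) z + dist z z' + dist z' (meshPoint (s n) x') := dist_triangle4 _ _ _ _
        _ ≤ s n + ‖z - z'‖ + s n := by
            gcongr
            · exact dist_meshPoint_nearestSite_le hn0 z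
            · exact (dist_eq_norm z z').le
            · rw [dist_comm]; exact dist_meshPoint_nearestSite_le hn0 z'
        _ = ‖z - z'‖ + 2 * s n := by ring
    simp only [hu, scaledEdgeFamily, ← mul_sub, norm_mul, norm_inv, Complex.norm_real, Real.norm_eq_abs,
      abs_of_nonneg (Real.sqrt_nonneg _)]
    have hsq : 0 < Real.sqrt (s n) := Real.sqrt_pos.2 hn0
    rw [inv_mul_le_iff₀ hsq]
    calc ‖F (s n) (cSrc (x, 0)) - F (s n) (cSrc (x', 0))‖
        ≤ L * Real.sqrt (s n) * (dist (meshPoint (s n) x) (meshPoint (s n) x') + s n) := key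
      _ ≤ L * Real.sqrt (s n) * ((‖z - z'‖ + 2 * s n) + s n) := by gcongr
      _ = Real.sqrt (s n) * (3 * L * ((‖z - z'‖ + 3 * s n) / 3)) := by ring
      _ ≤ Real.sqrt (s n) * (3 * L * (‖z - z'‖ + s n)) := by
          gcongr
          linarith [norm_nonneg (z - z')]

end Literature.Probability.LatticeModels
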